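/-
Origin: expansion seat `planner-pub-hodgecm-pohl-g3-0`, handover 2026-08-18 (`HOME/pub-hodgecm-pohl-g3/lean/Pohl3/EndStateFacts.lean`, md5 2974f672, 69 lines);
landed by the gen-6 packager in gate run 22 as `HodgeCM/Assembly/CorCMEndStateFacts.lean` (verbatim).
-/
/-
Copyright: pub-hodgecm formalisation cell (harness21, 2026). New file (not vendored).
Origin: HOME/pub-hodgecm-pohl-g3/lean/Pohl3/EndStateFacts.lean — session planner-pub-hodgecm-pohl-g3-0 (unit pub-hodgecm-pohl-g3,
part (b) gen 3), answering referee A round 14 S1 (REFEREE.md l. 1204): the end-state theorems with the four textbook facts N1–N4 in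
place of M29/M30.  OPTIONAL convenience file; intended final place `HodgeCM/Assembly/CorCMEndStateFacts.lean` (imports landed
modules only, no rewrite).  Nothing new is proved: each theorem is the landed end state composed with
`Universe.weightSpan_of_facts` / `Universe.weightHodge_of_facts` (gate run 20).
-/
import Summits.HodgeConjecture.HodgeCM.Assembly.CorCMEndState
import Summits.HodgeConjecture.HodgeCM.Assembly.CorCMHeckeSeesaw
import Summits.HodgeConjecture.HodgeCM.Proofs.Pohlmann.WeightHodge

set_option autoImplicit false

/-!
# The end state with N1–N4 in place of M29/M30 (referee A round 14, S1)

Since gate run 20, M29 `Fact_weightSpan` and M30 `Fact_weightHodge` are THEOREMS of the 28 model facts and the four textbook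
facts N1 `Fact_cupExterior`, N2 `Fact_cup_hodge`, N3 `Fact_pull_H0`, N4 `Fact_hodge_F0` (`Geometry/CupFacts.lean`;
`Universe.weightSpan_of_facts`, `Universe.weightHodge_of_facts`, `Universe.pohlmannSpan_of_facts`).  This file records the
three end-state theorems (`COR_CM_endState`, `COR_CM_endState_hecke`, `COR_CM_endState_ball`) with `(hN1) (hN2) (hN3) (hN4)`
replacing `(h29) (h30)`, so that the audited list can carry the cone "28 model facts + four textbook facts + …" under one
name each:

  `HC_CM ⇐ ModelAxioms ∧ N1 ∧ N2 ∧ N3 ∧ N4 ∧ Qw8ExtProd ∧ Qw8DualPushPull ∧ Qw8Milne ∧ <theta inputs> ∧ Fact_hodgeRiemann20`.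
-/

noncomputable section

namespace HodgeCM
namespace Assembly

open Universe

variable (U : Universe)

/-- **COR-CM, end state, textbook-fact form**: as `COR_CM_endState` with N1–N4 (`Fact_cupExterior`, `Fact_cup_hodge`,
`Fact_pull_H0`, `Fact_hodge_F0`) in place of M29/M30. -/
theorem COR_CM_endState_of_facts (M : U.ModelAxioms) (hN1 : U.Fact_cupExterior) (hN2 : U.Fact_cup_hodge)
    (hN3 : U.Fact_pull_H0) (hN4 : U.Fact_hodge_F0) (hE : U.Qw8ExtProd) (hD : U.Qw8DualPushPull) (hMi : U.Qw8Milne)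
    (T : U.ThetaModel) (A : T.Inputs) (hHR : U.Fact_hodgeRiemann20) : U.HC_CM :=
  COR_CM_endState U M (weightSpan_of_facts M hN1 hN3) (weightHodge_of_facts M hN1 hN2 hN3 hN4) hE hD hMi T A hHR

/-- **END STATE, Hecke route, textbook-fact form**: as `COR_CM_endState_hecke` with N1–N4 in place of M29/M30. -/
theorem COR_CM_endState_hecke_of_facts (M : U.ModelAxioms) (hN1 : U.Fact_cupExterior) (hN2 : U.Fact_cup_hodge)
    (hN3 : U.Fact_pull_H0) (hN4 : U.Fact_hodge_F0) (hE : U.Qw8ExtProd) (hD : U.Qw8DualPushPull) (hMi : U.Qw8Milne)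
    (T : U.ThetaModel) {Hk : U.HeckeData} (hH : T.HeckeInputs Hk) (hS : T.Open_supply)
    (h₁ : T.Fact_embCover) (h₂ : T.Fact_innerEmb) (h₃ : T.Design_kappaConj) (h₄ : T.Design_frameSignConj)
    (h₅ : T.Open_thetaSub) (h₇ : T.Open_thetaGen12) (h₈ : T.Open_thetaReal34) (h₉ : T.Open_chars)
    (h₁₀ : T.Open_occ) (hHR : U.Fact_hodgeRiemann20) : U.HC_CM :=
  COR_CM_endState_hecke U M (weightSpan_of_facts M hN1 hN3) (weightHodge_of_facts M hN1 hN2 hN3 hN4) hE hD hMi T hH hS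
    h₁ h₂ h₃ h₄ h₅ h₇ h₈ h₉ h₁₀ hHR

/-- **END STATE, ball route, textbook-fact form**: as `COR_CM_endState_ball` with N1–N4 in place of M29/M30. -/
theorem COR_CM_endState_ball_of_facts (M : U.ModelAxioms) (hN1 : U.Fact_cupExterior) (hN2 : U.Fact_cup_hodge)
    (hN3 : U.Fact_pull_H0) (hN4 : U.Fact_hodge_F0) (hE : U.Qw8ExtProd) (hD : U.Qw8DualPushPull) (hMi : U.Qw8Milne)
    (T : U.ThetaModel)
    (B : ∀ {L : CMField} {ι₁ : L →+* ℂ} (V : HermSpace3 L ι₁) (c : SeesawCtx L), U.BallData V c)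
    (hB : T.BallInputs B) (hS : T.Open_supply)
    (h₁ : T.Fact_embCover) (h₂ : T.Fact_innerEmb) (h₃ : T.Design_kappaConj) (h₄ : T.Design_frameSignConj)
    (h₅ : T.Open_thetaSub) (h₇ : T.Open_thetaGen12) (h₈ : T.Open_thetaReal34) (h₉ : T.Open_chars)
    (h₁₀ : T.Open_occ) (hHR : U.Fact_hodgeRiemann20) : U.HC_CM :=
  COR_CM_endState_ball U M (weightSpan_of_facts M hN1 hN3) (weightHodge_of_facts M hN1 hN2 hN3 hN4) hE hD hMi T B hB hS
    h₁ h₂ h₃ h₄ h₅ h₇ h₈ h₉ h₁₀ hHR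

end Assembly
end HodgeCM

end
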